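import Literature.Computability.AlgebraicComplexity.MS21DenseOrbitsHittingSets
import Literature.Algebra.Polynomial.JacobianCriterion
import Mathlib.Algebra.MvPolynomial.PDeriv
import Mathlib.LinearAlgebra.Matrix.NonsingularInverse
import Mathlib.LinearAlgebra.Matrix.SchurComplement
import HarnessLib

/-!
# Medini–Shpilka 2021, §3: `k`-independent polynomial maps and their properties — proofs

Theorem-only toolkit (cell `val-lit`, seat t24; D-0064: one file for §3 of the source) for the
`k`-independent polynomial maps of `MS21DenseOrbitsHittingSets.lean` (`MS2021.IsOneIndependent`,
`MS2021.IsIndependent`: block `l` of a `k`-independent map uses the variables `(l, ·)` of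
`Fin k × (Fin t ⊕ Unit)`, `Sum.inl s` = `y_s`, `Sum.inr ()` = `z`). These are the lemmas every
hitting-set statement of the paper invokes (Thm 28, Thm 33, Thm 35, Thm 43, Lemma 6.2 / Cor 6.3 /
Thm 45); they are proved here once, in the forms the typed facts `MS2021_thm_43` etc. consume.
Source: D. Medini, A. Shpilka, CCC 2021 (LIPIcs 200:19) = arXiv:2102.05632, §3 "k-independent
polynomial maps and their properties" (arXiv held text `paper:arxiv-2102.05632`, p0017–p0018;
CCC §3, p.19:16–19:18).

Contents (arXiv numbering; every item is a `theorem`, no definition and no named fact is added):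

* **Observation 3.1.** (2) "the `n` coordinates of any `k`-independent map (`k ≥ 1`) are
  `F`-linearly independent" (`IsIndependent.linearIndependent`), through the BLOCK EVALUATION
  `IsIndependent.exists_aeval_eq_single`: for every `i` some substitution of the variables sends
  `G_j ↦ δ_{ij} z` (the defining property of a `1`-independent map, lifted to `k ≥ 1` blocks by
  killing the other blocks; `IsIndependent.exists_aeval_eq_sum_single`: one free coordinate per
  block, `G_j ↦ Σ_{l : i_l = j} z_l`); hence the form used throughout the paper as "(obs:kwise)
  ((item:coordsGenInd))": a non-zero AFFINE function composed with `G` is non-zero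
  (`affine_bind₁_ne_zero`). (1) in the shape the inductions on `k` use: PEELING
  `isIndependent_succ_iff` — a `(k+1)`-independent map is a `1`-independent block plus a
  variable-disjoint `k`-independent map — together with the transport between the product-indexed
  variables `Fin (k+1) × V` and the sum `V ⊕ (Fin k × V)` (`bind₁_peel_eq_rename`,
  `bind₁_peel_ne_zero_iff`). (3) is not used by the typed statements and is not rendered.
* **Def 3.6 / Def 3.7 / Lemma 3.8** (directional derivative `∂f/∂v = Σ_i v_i ∂f/∂x_i`, written
  inline as `∑ i, C (v i) * pderiv i f`; dual set; "`∂f/∂v_i = (∂g/∂y_i)(ℓ_1(x), …, ℓ_m(x))`" for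
  `f = g(ℓ(x) + b)` and `v_i` dual to the `ℓ`'s): `sum_C_mul_pderiv_affSubst` for the tree's
  `MS2021.affSubst h A b g = g(Ax + b)` with the dual vector = column `castLE i` of `A⁻¹`; corollary
  `exists_dirDeriv_mem_affOrbit_pderiv` ("a suitable directional derivative of `f ∈ g^{GLaff_n}` lies
  in `(∂g/∂y_i)^{GLaff_n}`", the step of Thm 43, Case 1).
* **Lemma 3.9** (`k = 1`; "(∂f/∂v) ∘ H ≠ 0 ⇒ f ∘ (G + H) ≠ 0" for a `1`-independent `G`
  variable-disjoint from an ARBITRARY polynomial map `H`): `bind₁_sum_ne_zero_of_pderiv`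
  (coordinate derivative), `bind₁_sum_ne_zero_of_dirDeriv` (directional), and the product-variable
  form `bind₁_peel_ne_zero_of_dirDeriv` (`H` = a `k`-independent map on `Fin k × V`). The general
  `k` of the printed lemma (`IsIndependent.bind₁_sum_ne_zero_of_iterate_dirDeriv`) is the `k`-fold
  iteration of the `k = 1` case with `H ← H + G_2 + ⋯ + G_k` (the printed proof's first sentence;
  iteration principle `bind₁_sum_ne_zero_of_foldr`). Chain rule = the tree's
  `JacobianCriterion.pderiv_aeval`.
* **Lemma 3.10** (`k = 1`; "project to `ℓ_1 = 0` using a `1`-independent map"): the substitution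
  step `bind₁_sum_ne_zero_of_shift` ("`f(x + G_1(α, L(x))) ∘ H ≠ 0 ⇒ f ∘ (G_1 + H) ≠ 0`", valid for
  EVERY polynomial `L`), and the projection identity `exists_shift_affSubst_eq` for the tree's
  `affSubst`: for `f = g(Ax + b)`, `A ∈ GL_n`, and a coordinate `r ≤ m`, there are `i`, an affine `L`
  and `(Ã, b̃) ∈ GLaff_n` with `f(x + L(x)·e_i) = g̃(Ãx + b̃)`, `g̃ = g|_{y_r = 0}` (so
  `f(x + L e_i) ∈ g̃^{GLaff_n}`, `exists_shift_mem_affOrbit`); product-variable form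
  `bind₁_peel_ne_zero_of_shift`. General `k` = iteration
  (`IsIndependent.bind₁_sum_ne_zero_of_iterate_shift`, sequential shifts).

Deviations / rendering: the paper's `ℓ_i` in Lemmas 3.8/3.10 are any linearly independent affine
functions; here they are the first `m` rows of an invertible `n × n` matrix `A` plus constants `b`,
which is how the tree's orbits `MS2021.affOrbit` present them (no loss: linearly independent rows
extend to an invertible matrix, and conversely). `Ã` is `A` with multiples of row `r` added to the
other rows (`Ã = E·A`, `det E = 1` by the matrix determinant lemma), so `g̃` is kept `m`-variate with
`y_r ↦ 0` instead of dropping the variable. HONEST FRAMING: infrastructure for discharging typed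
literature statements; `VP ≠ VNP` is NOT proved and nothing here bears on it.

## References
* [MediniShpilka2021] D. Medini, A. Shpilka, *Hitting sets and reconstruction for dense orbits in
  VP_e and ΣΠΣ circuits*, CCC 2021, LIPIcs 200:19 = arXiv:2102.05632 — §3: Obs 3.1, Defs 3.6–3.7,
  Lemmas 3.8, 3.9, 3.10 (arXiv p0017.txt:L5-L11, L44-L73; p0018.txt:L1-L40).
* [Humphreys1990] (chain rule, via `Literature.Algebra.Polynomial.JacobianCriterion.pderiv_aeval`).
-/

noncomputable section

open MvPolynomial Matrix

namespace Literature.Computability.AlgebraicComplexity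

namespace MS2021

/-! ### Observation 3.1 (2): block evaluation, non-vanishing of affine functions, linear independence -/

section Evaluation

variable {K : Type*} [CommSemiring K] {n t : ℕ}

/-- The defining property of a `1`-independent map as a substitution into `K[z]`: for every `i`
some algebra map sends `G_j ↦ δ_{ij}·z`. [cite: MediniShpilka2021, Def 19 (CCC p.19:9; arXiv ‹Def 1.15› p0006.txt:L64-65)] -/
theorem IsOneIndependent.exists_aeval_eq_single {G : Fin n → MvPolynomial (Fin t ⊕ Unit) K}
    (hG : IsOneIndependent G) (i : Fin n) :
    ∃ φ : Fin t ⊕ Unit → MvPolynomial Unit K, ∀ j, aeval φ (G j) = if j = i then X () else 0 := by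
  obtain ⟨a, ha⟩ := hG i
  exact ⟨Sum.elim (fun s => C (a s)) (fun _ => X ()), ha⟩

/-- **Block evaluation** (Obs 3.1 (1)–(2) combined, `k ≥ 1`): for every `i` some substitution of all
the variables of a `k`-independent map sends `G_j ↦ δ_{ij}·z` — block `0` is evaluated at its
assignment for `i` with `z_0 ↦ z`, every other block at an assignment with its `z`-variable set to
`0` ("`G` restricted to `S = α` is a `[k]`" iterated down to one block).
[cite: MediniShpilka2021, Obs 3.1 (arXiv p0017.txt:L7-L9; CCC §3)] -/
theorem IsIndependent.exists_aeval_eq_single {k : ℕ}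
    {G : Fin n → MvPolynomial (Fin k × (Fin t ⊕ Unit)) K} (hG : IsIndependent k G) (hk : 1 ≤ k)
    (i : Fin n) :
    ∃ φ : Fin k × (Fin t ⊕ Unit) → MvPolynomial Unit K,
      ∀ j, aeval φ (G j) = if j = i then X () else 0 := by
  classical
  obtain ⟨Gs, hGs, hG⟩ := hG
  choose a ha using fun l => hGs l i
  set l₀ : Fin k := ⟨0, hk⟩
  refine ⟨fun p => Sum.elim (fun s => C (a p.1 s))
    (fun _ => if p.1 = l₀ then (X () : MvPolynomial Unit K) else 0) p.2, fun j => ?_⟩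
  have key : ∀ l : Fin k,
      aeval (fun p : Fin k × (Fin t ⊕ Unit) => Sum.elim (fun s => C (a p.1 s))
        (fun _ => if p.1 = l₀ then (X () : MvPolynomial Unit K) else 0) p.2)
        (rename (Prod.mk l) (Gs l j)) = if l = l₀ then (if j = i then X () else 0) else 0 := by
    intro l
    rw [aeval_rename]
    have hcomp : (fun p : Fin k × (Fin t ⊕ Unit) => Sum.elim (fun s => C (a p.1 s))
        (fun _ => if p.1 = l₀ then (X () : MvPolynomial Unit K) else 0) p.2) ∘ Prod.mk l =
        fun v => aeval (fun _ : Unit => if l = l₀ then (X () : MvPolynomial Unit K) else 0)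
          (Sum.elim (fun s => C (a l s)) (fun _ => X ()) v) := by
      funext v
      rcases v with s | u
      · simp
      · simp
    rw [hcomp, ← comp_aeval, AlgHom.comp_apply, ha l j]
    split_ifs <;> simp_all
  simp_rw [hG j, map_sum, key]
  rw [Finset.sum_ite_eq' Finset.univ l₀, if_pos (Finset.mem_univ _)]

/-- **Coordinate projections** (Obs 3.1 for several blocks at once): for a `k`-independent map and
ANY choice of one index `i_l` per block, some substitution of all the variables sends
`G_j ↦ Σ_{l : i_l = j} z_l` — block `l` is evaluated at its assignment for `i_l` with `z_l` kept as the
`l`-th variable of `K[z_1..z_k]` (so for distinct `i_l` the map `G` specialises to the coordinate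
embedding `z ↦ Σ_l z_l e_{i_l}`: "`G` is a sum of `k` variable-disjoint `1`-independent maps", each
contributing one free coordinate). [cite: MediniShpilka2021, Def 19 and Obs 3.1 (arXiv p0006.txt:L64-65, p0017.txt:L7-L9)] -/
theorem IsIndependent.exists_aeval_eq_sum_single {k : ℕ}
    {G : Fin n → MvPolynomial (Fin k × (Fin t ⊕ Unit)) K} (hG : IsIndependent k G)
    (i : Fin k → Fin n) :
    ∃ φ : Fin k × (Fin t ⊕ Unit) → MvPolynomial (Fin k) K,
      ∀ j, aeval φ (G j) = ∑ l : Fin k, if j = i l then X l else 0 := by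
  classical
  obtain ⟨Gs, hGs, hG⟩ := hG
  choose a ha using fun l => hGs l (i l)
  refine ⟨fun p => Sum.elim (fun s => C (a p.1 s)) (fun _ => (X p.1 : MvPolynomial (Fin k) K)) p.2,
    fun j => ?_⟩
  have key : ∀ l : Fin k,
      aeval (fun p : Fin k × (Fin t ⊕ Unit) => Sum.elim (fun s => C (a p.1 s))
        (fun _ => (X p.1 : MvPolynomial (Fin k) K)) p.2) (rename (Prod.mk l) (Gs l j)) =
        if j = i l then X l else 0 := by
    intro l
    rw [aeval_rename]
    have hcomp : (fun p : Fin k × (Fin t ⊕ Unit) => Sum.elim (fun s => C (a p.1 s))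
        (fun _ => (X p.1 : MvPolynomial (Fin k) K)) p.2) ∘ Prod.mk l =
        fun v => aeval (fun _ : Unit => (X l : MvPolynomial (Fin k) K))
          (Sum.elim (fun s => C (a l s)) (fun _ => X ()) v) := by
      funext v
      rcases v with s | u
      · simp
      · simp
    rw [hcomp, ← comp_aeval, AlgHom.comp_apply, ha l j]
    split_ifs
    · rw [aeval_X]
    · rw [map_zero]
  simp_rw [hG j, map_sum, key]

/-- A non-zero AFFINE function `Σ_j c_j x_j + d` (`c ≠ 0`) composed with a polynomial map having the
block-evaluation property is non-zero — the form in which the paper uses "(obs:kwise)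
((item:coordsGenInd))" (e.g. Thm 43, base case: "a non-zero linear function composed with a
`[t+1]` is non-zero"). [cite: MediniShpilka2021, Obs 3.1 (2) (arXiv p0017.txt:L9; proof of Thm 43, p0034.txt:L41-L42)] -/
theorem affine_bind₁_ne_zero {σ : Type*} {G : Fin n → MvPolynomial σ K}
    (hG : ∀ i, ∃ φ : σ → MvPolynomial Unit K, ∀ j, aeval φ (G j) = if j = i then X () else 0)
    (c : Fin n → K) (d : K) (hc : ∃ j, c j ≠ 0) :
    (∑ j, C (c j) * G j) + C d ≠ 0 := by
  classical
  obtain ⟨i, hi⟩ := hc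
  obtain ⟨φ, hφ⟩ := hG i
  intro h
  have h1 : aeval φ ((∑ j, C (c j) * G j) + C d) = C (c i) * X () + C d := by
    simp only [map_add, map_sum, map_mul, algHom_C, MvPolynomial.algebraMap_eq, hφ, mul_ite,
      mul_zero, Finset.sum_ite_eq', Finset.mem_univ, if_true]
  have hne : (0 : Unit →₀ ℕ) ≠ Finsupp.single () 1 :=
    (Finsupp.single_ne_zero.mpr one_ne_zero).symm
  have h2 : coeff (Finsupp.single () 1) (C (c i) * X () + C d : MvPolynomial Unit K) = c i := by
    rw [coeff_add, coeff_C_mul, coeff_X, coeff_C, if_neg hne]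
    simp
  rw [h, map_zero] at h1
  rw [← h1, coeff_zero] at h2
  exact hi h2.symm

/-- The affine form `bind₁ G (Σ_j C c_j X_j + C d) = Σ_j C c_j G_j + C d`. [folklore] -/
private theorem bind₁_affine {σ : Type*} (G : Fin n → MvPolynomial σ K) (c : Fin n → K) (d : K) :
    bind₁ G ((∑ j, C (c j) * X j) + C d) = (∑ j, C (c j) * G j) + C d := by
  simp [map_sum, bind₁_X_right]

/-- "(obs:kwise)((item:coordsGenInd))" for a `1`-independent map: a non-zero affine function
composed with `G` is non-zero. [cite: MediniShpilka2021, Obs 3.1 (2) (arXiv p0017.txt:L9)] -/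
theorem IsOneIndependent.bind₁_affine_ne_zero {G : Fin n → MvPolynomial (Fin t ⊕ Unit) K}
    (hG : IsOneIndependent G) (c : Fin n → K) (d : K) (hc : ∃ j, c j ≠ 0) :
    bind₁ G ((∑ j, C (c j) * X j) + C d) ≠ 0 := by
  rw [bind₁_affine]
  exact affine_bind₁_ne_zero (fun i => hG.exists_aeval_eq_single i) c d hc

/-- "(obs:kwise)((item:coordsGenInd))" for a `k`-independent map, `k ≥ 1`: a non-zero affine
function composed with `G` is non-zero. [cite: MediniShpilka2021, Obs 3.1 (2) (arXiv p0017.txt:L9); proof of Thm 43 base case (p0034.txt:L41-L42)] -/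
theorem IsIndependent.bind₁_affine_ne_zero {k : ℕ}
    {G : Fin n → MvPolynomial (Fin k × (Fin t ⊕ Unit)) K} (hG : IsIndependent k G) (hk : 1 ≤ k)
    (c : Fin n → K) (d : K) (hc : ∃ j, c j ≠ 0) :
    bind₁ G ((∑ j, C (c j) * X j) + C d) ≠ 0 := by
  rw [bind₁_affine]
  exact affine_bind₁_ne_zero (fun i => hG.exists_aeval_eq_single hk i) c d hc

end Evaluation

section LinearIndependence

variable {K : Type*} [Field K] {n t : ℕ}

/-- **Obs 3.1 (2).** "For any `k ≥ 1`, the `n` coordinates of any `[k]` are `F`-linearly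
independent." [cite: MediniShpilka2021, Obs 3.1 (2) (arXiv p0017.txt:L9; CCC §3)] -/
theorem IsIndependent.linearIndependent {k : ℕ}
    {G : Fin n → MvPolynomial (Fin k × (Fin t ⊕ Unit)) K} (hG : IsIndependent k G) (hk : 1 ≤ k) :
    LinearIndependent K G := by
  rw [Fintype.linearIndependent_iff]
  intro c hc
  by_contra hne
  push Not at hne
  have h := affine_bind₁_ne_zero (fun i => hG.exists_aeval_eq_single hk i) c 0 hne
  apply h
  rw [map_zero, add_zero, ← hc]
  exact Finset.sum_congr rfl fun j _ => (smul_eq_C_mul (G j) (c j)).symm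

/-- **Obs 3.1 (2)**, `k = 1` in the `IsOneIndependent` presentation: the coordinates of a
`1`-independent map are linearly independent. [cite: MediniShpilka2021, Obs 3.1 (2) (arXiv p0017.txt:L9)] -/
theorem IsOneIndependent.linearIndependent {G : Fin n → MvPolynomial (Fin t ⊕ Unit) K}
    (hG : IsOneIndependent G) : LinearIndependent K G := by
  rw [Fintype.linearIndependent_iff]
  intro c hc
  by_contra hne
  push Not at hne
  have h := affine_bind₁_ne_zero (fun i => hG.exists_aeval_eq_single i) c 0 hne
  apply h
  rw [map_zero, add_zero, ← hc]
  exact Finset.sum_congr rfl fun j _ => (smul_eq_C_mul (G j) (c j)).symm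

end LinearIndependence

/-! ### Observation 3.1 (1): peeling one block off a `(k+1)`-independent map -/

section Peel

variable {K : Type*} [CommSemiring K] {n t k : ℕ}

/-- **Peeling** (Obs 3.1 (1) in the shape used by every induction on `k`): a `(k+1)`-independent
map is `G_1(y_0, z_0) + G'`, with `G_1` a `1`-independent block in the variables `(0, ·)` and `G'` a
`k`-independent map in the variables `(l+1, ·)` ("`G = G_1 + G_t`" in the proofs of Lemma 3.9,
Thm 43, Lemma 6.2). [cite: MediniShpilka2021, Obs 3.1 (1) and Def 19 (arXiv p0017.txt:L7-L8; p0006.txt:L65)] -/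
theorem isIndependent_succ_iff {G : Fin n → MvPolynomial (Fin (k + 1) × (Fin t ⊕ Unit)) K} :
    IsIndependent (k + 1) G ↔
      ∃ (G₁ : Fin n → MvPolynomial (Fin t ⊕ Unit) K)
        (G' : Fin n → MvPolynomial (Fin k × (Fin t ⊕ Unit)) K),
        IsOneIndependent G₁ ∧ IsIndependent k G' ∧
          ∀ j, G j = rename (Prod.mk 0) (G₁ j) + rename (Prod.map Fin.succ id) (G' j) := by
  have hrr : ∀ (l : Fin k) (p : MvPolynomial (Fin t ⊕ Unit) K),
      rename (Prod.map Fin.succ id) (rename (Prod.mk l) p) =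
        rename (Prod.mk (l.succ : Fin (k + 1))) p := by
    intro l p
    rw [rename_rename]
    rfl
  constructor
  · rintro ⟨Gs, hGs, hG⟩
    refine ⟨Gs 0, fun j => ∑ l : Fin k, rename (Prod.mk l) (Gs l.succ j), hGs 0,
      ⟨fun l => Gs l.succ, fun l => hGs l.succ, fun j => rfl⟩, fun j => ?_⟩
    rw [hG j, Fin.sum_univ_succ, map_sum]
    simp_rw [hrr]
  · rintro ⟨G₁, G', hG₁, ⟨Gs', hGs', hG'⟩, hG⟩
    refine ⟨Fin.cons G₁ Gs', fun l => ?_, fun j => ?_⟩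
    · refine Fin.cases ?_ (fun l => ?_) l
      · simpa using hG₁
      · simpa using hGs' l
    · rw [hG j, hG' j, Fin.sum_univ_succ, map_sum]
      simp_rw [hrr]
      rfl

/-- The variable embedding `V ⊕ (Fin k × V) → Fin (k+1) × V` used to peel: block `0` and the shift
`l ↦ l+1` of the remaining blocks ("variable-disjoint" blocks, Def 19). It is injective.
[cite: MediniShpilka2021, Def 19 and Obs 3.1 (1) (arXiv p0006.txt:L65, p0017.txt:L7-L8)] -/
theorem sumElim_prodMk_injective :
    Function.Injective (Sum.elim (Prod.mk (0 : Fin (k + 1))) (Prod.map Fin.succ id) :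
      (Fin t ⊕ Unit) ⊕ (Fin k × (Fin t ⊕ Unit)) → Fin (k + 1) × (Fin t ⊕ Unit)) := by
  rintro (v | ⟨l, v⟩) (w | ⟨l', w⟩) h
  · simp only [Sum.elim_inl, Prod.mk.injEq, true_and] at h
    rw [h]
  · simp only [Sum.elim_inl, Sum.elim_inr, Prod.map, id_eq, Prod.mk.injEq] at h
    exact absurd h.1.symm (Fin.succ_ne_zero l')
  · simp only [Sum.elim_inl, Sum.elim_inr, Prod.map, id_eq, Prod.mk.injEq] at h
    exact absurd h.1 (Fin.succ_ne_zero l)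
  · simp only [Sum.elim_inr, Prod.map, id_eq, Prod.mk.injEq, Fin.succ_inj] at h
    rw [h.1, h.2]

/-- Transport: composing with a peeled map `G_1 + G'` in the product variables is the renaming of
the composition with `G_1 ⊕ G'` in the sum variables ("`G = G_1(y_1, z_1) + … + G_k(y_k, z_k)` for
some variable-disjoint `1`-independent maps").
[cite: MediniShpilka2021, Obs 3.1 (1) and proof of Lemma 3.9, first sentence (arXiv p0017.txt:L7-L8, p0018.txt:L2)] -/
theorem bind₁_peel_eq_rename (G₁ : Fin n → MvPolynomial (Fin t ⊕ Unit) K)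
    (G' : Fin n → MvPolynomial (Fin k × (Fin t ⊕ Unit)) K) (f : MvPolynomial (Fin n) K) :
    bind₁ (fun j => rename (Prod.mk 0) (G₁ j) + rename (Prod.map Fin.succ id) (G' j)) f =
      rename (Sum.elim (Prod.mk (0 : Fin (k + 1))) (Prod.map Fin.succ id))
        (bind₁ (fun j => rename Sum.inl (G₁ j) + rename Sum.inr (G' j)) f) := by
  have hF : (fun j => rename (Prod.mk (0 : Fin (k + 1))) (G₁ j) + rename (Prod.map Fin.succ id) (G' j)) =
      fun j => rename (Sum.elim (Prod.mk (0 : Fin (k + 1))) (Prod.map Fin.succ id))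
        (rename Sum.inl (G₁ j) + rename Sum.inr (G' j)) := by
    funext j
    rw [map_add, rename_rename, rename_rename]
    rfl
  rw [rename_bind₁, hF]

/-- Transport of non-vanishing between the product and the sum presentations of a peeled map
(renaming along an injective variable map is injective).
[cite: MediniShpilka2021, Obs 3.1 (1) (arXiv p0017.txt:L7-L8)] -/
theorem bind₁_peel_ne_zero_iff (G₁ : Fin n → MvPolynomial (Fin t ⊕ Unit) K)
    (G' : Fin n → MvPolynomial (Fin k × (Fin t ⊕ Unit)) K) (f : MvPolynomial (Fin n) K) :
    bind₁ (fun j => rename (Prod.mk 0) (G₁ j) + rename (Prod.map Fin.succ id) (G' j)) f ≠ 0 ↔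
      bind₁ (fun j => rename Sum.inl (G₁ j) + rename Sum.inr (G' j)) f ≠ 0 := by
  rw [bind₁_peel_eq_rename]
  exact (rename_injective _ sumElim_prodMk_injective).ne_iff' (map_zero _)

end Peel

/-! ### Lemma 3.9 (`k = 1`): derivatives through a `1`-independent block -/

section DerivLinear

variable {K : Type*} [CommRing K] {n t : ℕ}

/-- A polynomial in the second group of variables has no derivative in the first. [folklore] -/
private theorem pderiv_inl_rename_inr {σ τ : Type*} (u : σ) (q : MvPolynomial τ K) :
    pderiv (Sum.inl u) (rename Sum.inr q : MvPolynomial (σ ⊕ τ) K) = 0 := by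
  classical
  refine pderiv_eq_zero_of_notMem_vars fun hmem => ?_
  obtain ⟨j, -, hj⟩ := Finset.mem_image.mp (vars_rename Sum.inr q hmem)
  exact Sum.inr_ne_inl hj

/-- `aeval (X ∘ f) = rename f`. [folklore] -/
private theorem aeval_X_comp_eq_rename {σ τ : Type*} (f : σ → τ) (p : MvPolynomial σ K) :
    aeval (fun s => (X (f s) : MvPolynomial τ K)) p = rename f p := by
  induction p using MvPolynomial.induction_on with
  | C a => rw [algHom_C, algHom_C]
  | add p q hp hq => rw [map_add, map_add, hp, hq]
  | mul_X p s hp => rw [map_mul, map_mul, hp, aeval_X, rename_X]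

/-- **Lemma 3.9, `k = 1`** (coordinate form of the hypothesis). `G_1(y, z)` a `1`-independent map,
`H(w)` ANY polynomial map in disjoint variables, `f ∈ K[x_1..x_n]`: if `(∂f/∂x_i) ∘ H ≠ 0` for some
`i` then `f ∘ (G_1 + H) ≠ 0`. Printed proof: substitute `y := α_i`, so that
`g := f ∘ (G_1 + H)|_{y = α_i} = f(H_1, …, z + H_i, …, H_n)`; then `∂g/∂z = (∂f/∂x_i)(…, z + H_i, …)`
(chain rule, `H` free of `z`) and `∂g/∂z |_{z = 0} = (∂f/∂x_i) ∘ H ≠ 0`.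
[cite: MediniShpilka2021, Lemma 3.9 (arXiv p0017.txt:L70-L73, proof p0018.txt:L1-L13; CCC §3)] -/
theorem bind₁_sum_ne_zero_of_pderiv {τ : Type*} {G₁ : Fin n → MvPolynomial (Fin t ⊕ Unit) K}
    (hG₁ : IsOneIndependent G₁) (H : Fin n → MvPolynomial τ K) (f : MvPolynomial (Fin n) K)
    (i : Fin n) (h : bind₁ H (pderiv i f) ≠ 0) :
    bind₁ (fun j => rename Sum.inl (G₁ j) + rename Sum.inr (H j)) f ≠ 0 := by
  classical
  obtain ⟨a, ha⟩ := hG₁ i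
  -- `g = f(H_1, …, z + H_i, …, H_n)` is `aeval Φ' f` for the following `Φ'`
  obtain ⟨Φ', hΦ'def⟩ : ∃ Φ' : Fin n → MvPolynomial (Unit ⊕ τ) K,
      Φ' = fun j => (if j = i then X (Sum.inl ()) else 0) + rename Sum.inr (H j) := ⟨_, rfl⟩
  -- the substitution `y := α_i`, keeping `z` and the variables of `H`, maps `G_1 ⊕ H` to `Φ'`
  have hΦ' : ∀ j, aeval (Sum.elim (Sum.elim (fun s => C (a s)) (fun u => X (Sum.inl u)))
      (fun w => X (Sum.inr w)) : (Fin t ⊕ Unit) ⊕ τ → MvPolynomial (Unit ⊕ τ) K)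
      (rename Sum.inl (G₁ j) + rename Sum.inr (H j)) = Φ' j := by
    intro j
    rw [map_add, aeval_rename, aeval_rename, Sum.elim_comp_inl, Sum.elim_comp_inr,
      aeval_X_comp_eq_rename]
    have h1 : (Sum.elim (fun s => C (a s)) (fun u => X (Sum.inl u)) :
        Fin t ⊕ Unit → MvPolynomial (Unit ⊕ τ) K) =
        fun v => rename Sum.inl (Sum.elim (fun s => C (a s)) (fun _ => X ()) v) := by
      funext v
      rcases v with s | u
      · simp
      · simp
    rw [h1, ← comp_aeval, AlgHom.comp_apply, ha j, hΦ'def]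
    congr 1
    split_ifs
    · rw [rename_X]
    · rw [map_zero]
  intro hzero
  have hg : aeval Φ' f = 0 := by
    have e := congrArg (aeval (Sum.elim (Sum.elim (fun s => C (a s)) (fun u => X (Sum.inl u)))
      (fun w => X (Sum.inr w)) : (Fin t ⊕ Unit) ⊕ τ → MvPolynomial (Unit ⊕ τ) K)) hzero
    rw [aeval_bind₁, map_zero] at e
    rw [show Φ' = fun j => aeval (Sum.elim (Sum.elim (fun s => C (a s)) (fun u => X (Sum.inl u)))
      (fun w => X (Sum.inr w)) : (Fin t ⊕ Unit) ⊕ τ → MvPolynomial (Unit ⊕ τ) K)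
      (rename Sum.inl (G₁ j) + rename Sum.inr (H j)) from funext fun j => (hΦ' j).symm]
    exact e
  -- `∂g/∂z = (∂f/∂x_i)(Φ')` (chain rule; `H` is free of `z`)
  have hD : pderiv (Sum.inl ()) (aeval Φ' f) = aeval Φ' (pderiv i f) := by
    rw [_root_.Literature.Algebra.Polynomial.JacobianCriterion.pderiv_aeval]
    have hd : ∀ j, pderiv (Sum.inl ()) (Φ' j) = if j = i then 1 else 0 := by
      intro j
      rw [hΦ'def]
      dsimp only
      rw [map_add, pderiv_inl_rename_inr, add_zero]
      split_ifs
      · exact pderiv_X_self _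
      · exact map_zero _
    simp_rw [hd, mul_ite, mul_one, mul_zero, Finset.sum_ite_eq', Finset.mem_univ, if_true]
  -- `… |_{z = 0} = (∂f/∂x_i) ∘ H`
  have hρ : aeval (Sum.elim (fun _ : Unit => (0 : MvPolynomial τ K)) X) (aeval Φ' (pderiv i f)) =
      bind₁ H (pderiv i f) := by
    rw [← AlgHom.comp_apply, comp_aeval]
    have hH : (fun j => aeval (Sum.elim (fun _ : Unit => (0 : MvPolynomial τ K)) X) (Φ' j)) = H := by
      funext j
      rw [hΦ'def]
      dsimp only
      rw [map_add, aeval_rename, Sum.elim_comp_inr, aeval_X_left_apply]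
      split_ifs
      · rw [aeval_X, Sum.elim_inl, zero_add]
      · rw [map_zero, zero_add]
    rw [hH]
    rfl
  apply h
  rw [← hρ, ← hD, hg, map_zero, map_zero]

/-- **Lemma 3.9, `k = 1`** (as printed, with a directional derivative
`∂f/∂v = Σ_i v_i · ∂f/∂x_i`, Def 3.6): "`(∂f/∂v) ∘ H ≠ 0 ⇒ f ∘ (G + H) ≠ 0`" for a `1`-independent
`G` and any polynomial map `H` in disjoint variables ("By definition … `∂f/∂v ∘ H ≠ 0` implies that
there exists some `i ∈ [n]` such that `∂f/∂x_i ∘ H ≠ 0`"). The printed general `k` is the `k`-fold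
iteration of this statement with `H ← H + G_2 + ⋯ + G_k`.
[cite: MediniShpilka2021, Lemma 3.9 and Def 3.6 (arXiv p0017.txt:L44-L49, L70-L73; p0018.txt:L1-L13)] -/
theorem bind₁_sum_ne_zero_of_dirDeriv {τ : Type*} {G₁ : Fin n → MvPolynomial (Fin t ⊕ Unit) K}
    (hG₁ : IsOneIndependent G₁) (H : Fin n → MvPolynomial τ K) (f : MvPolynomial (Fin n) K)
    (v : Fin n → K) (h : bind₁ H (∑ i, C (v i) * pderiv i f) ≠ 0) :
    bind₁ (fun j => rename Sum.inl (G₁ j) + rename Sum.inr (H j)) f ≠ 0 := by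
  classical
  have hex : ∃ i, bind₁ H (pderiv i f) ≠ 0 := by
    by_contra hall
    push Not at hall
    apply h
    rw [map_sum]
    refine Finset.sum_eq_zero fun i _ => ?_
    rw [map_mul, bind₁_C_right, hall i, mul_zero]
  obtain ⟨i, hi⟩ := hex
  exact bind₁_sum_ne_zero_of_pderiv hG₁ H f i hi

/-- **Lemma 3.9, `k = 1`, product-variable form**: for a peeled `(k+1)`-independent map
`G = G_1 + G'` (`isIndependent_succ_iff`), "`(∂f/∂v) ∘ G' ≠ 0 ⇒ f ∘ G ≠ 0`" — the shape used in
Thm 43 (Case 1) and Lemma 6.2. [cite: MediniShpilka2021, Lemma 3.9 (arXiv p0017.txt:L70-L73); proof of Thm 43 Case 1 (p0034.txt:L50)] -/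
theorem bind₁_peel_ne_zero_of_dirDeriv {k : ℕ} {G₁ : Fin n → MvPolynomial (Fin t ⊕ Unit) K}
    (hG₁ : IsOneIndependent G₁) (G' : Fin n → MvPolynomial (Fin k × (Fin t ⊕ Unit)) K)
    (f : MvPolynomial (Fin n) K) (v : Fin n → K)
    (h : bind₁ G' (∑ i, C (v i) * pderiv i f) ≠ 0) :
    bind₁ (fun j => rename (Prod.mk 0) (G₁ j) + rename (Prod.map Fin.succ id) (G' j)) f ≠ 0 :=
  (bind₁_peel_ne_zero_iff G₁ G' f).mpr (bind₁_sum_ne_zero_of_dirDeriv hG₁ G' f v h)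

end DerivLinear

/-! ### Lemma 3.10 (`k = 1`): projecting to `ℓ_r = 0` through a `1`-independent block -/

section Shift

variable {K : Type*} [CommSemiring K] {n t : ℕ}

/-- **The substitution step of Lemma 3.10 / Thm 43 Case 2**: for a `1`-independent `G_1(y, z)`,
any polynomial map `H` in disjoint variables, any index `i` and ANY polynomial `L(x)`:
"`f(x + G_1(α, L(x))) ∘ H ≠ 0 ⇒ f(x + G_1(y, z)) ∘ H = f ∘ (G_1 + H) ≠ 0`" — because the former is
the image of the latter under `y := α_i`, `z := L(H)` ("`G(α, z_1)` has `z_1` in the `i`th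
coordinate, and `0` in all other coordinates").
[cite: MediniShpilka2021, Lemma 3.10 (arXiv p0018.txt:L17-L40) and proof of Thm 43 Case 2 (p0035.txt:L1)] -/
theorem bind₁_sum_ne_zero_of_shift {τ : Type*} {G₁ : Fin n → MvPolynomial (Fin t ⊕ Unit) K}
    (hG₁ : IsOneIndependent G₁) (H : Fin n → MvPolynomial τ K) (f : MvPolynomial (Fin n) K)
    (i : Fin n) (L : MvPolynomial (Fin n) K)
    (h : bind₁ H (bind₁ (fun j => X j + if j = i then L else 0) f) ≠ 0) :
    bind₁ (fun j => rename Sum.inl (G₁ j) + rename Sum.inr (H j)) f ≠ 0 := by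
  classical
  obtain ⟨a, ha⟩ := hG₁ i
  -- the substitution `y := α_i`, `z := L(H)`, `w := w`
  have hθ : ∀ j, aeval (Sum.elim (Sum.elim (fun s => C (a s)) (fun _ => bind₁ H L)) X :
      (Fin t ⊕ Unit) ⊕ τ → MvPolynomial τ K) (rename Sum.inl (G₁ j) + rename Sum.inr (H j)) =
      bind₁ H (X j + if j = i then L else 0) := by
    intro j
    rw [map_add, aeval_rename, aeval_rename, Sum.elim_comp_inl, Sum.elim_comp_inr,
      aeval_X_left_apply]
    have h1 : (Sum.elim (fun s => C (a s)) (fun _ => bind₁ H L) : Fin t ⊕ Unit → MvPolynomial τ K) =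
        fun v => aeval (fun _ : Unit => bind₁ H L) (Sum.elim (fun s => C (a s)) (fun _ => X ()) v) := by
      funext v
      rcases v with s | u
      · simp
      · simp
    rw [h1, ← comp_aeval, AlgHom.comp_apply, ha j, map_add, bind₁_X_right, add_comm]
    congr 1
    split_ifs
    · rw [aeval_X]
    · rw [map_zero, map_zero]
  intro hzero
  apply h
  have e := congrArg (aeval (Sum.elim (Sum.elim (fun s => C (a s)) (fun _ => bind₁ H L)) X :
      (Fin t ⊕ Unit) ⊕ τ → MvPolynomial τ K)) hzero
  rw [aeval_bind₁, map_zero] at e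
  rw [bind₁_bind₁, show (fun j => bind₁ H (X j + if j = i then L else 0)) =
    fun j => aeval (Sum.elim (Sum.elim (fun s => C (a s)) (fun _ => bind₁ H L)) X :
      (Fin t ⊕ Unit) ⊕ τ → MvPolynomial τ K) (rename Sum.inl (G₁ j) + rename Sum.inr (H j)) from
    funext fun j => (hθ j).symm]
  exact e

/-- Product-variable form of `bind₁_sum_ne_zero_of_shift` for a peeled `(k+1)`-independent map
`G = G_1 + G'`: "`f(x + G_1(α, L(x))) ∘ G' ≠ 0 ⇒ f ∘ G ≠ 0`" (Thm 43, Case 2).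
[cite: MediniShpilka2021, Lemma 3.10 and proof of Thm 43 Case 2 (arXiv p0018.txt:L17-L40, p0035.txt:L1)] -/
theorem bind₁_peel_ne_zero_of_shift {k : ℕ} {G₁ : Fin n → MvPolynomial (Fin t ⊕ Unit) K}
    (hG₁ : IsOneIndependent G₁) (G' : Fin n → MvPolynomial (Fin k × (Fin t ⊕ Unit)) K)
    (f : MvPolynomial (Fin n) K) (i : Fin n) (L : MvPolynomial (Fin n) K)
    (h : bind₁ G' (bind₁ (fun j => X j + if j = i then L else 0) f) ≠ 0) :
    bind₁ (fun j => rename (Prod.mk 0) (G₁ j) + rename (Prod.map Fin.succ id) (G' j)) f ≠ 0 :=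
  (bind₁_peel_ne_zero_iff G₁ G' f).mpr (bind₁_sum_ne_zero_of_shift hG₁ G' f i L h)

end Shift

/-! ### Def 3.7 / Lemma 3.8: derivatives along a dual set, for the orbits `g(Ax + b)` -/

section DualDerivative

variable {K : Type*} [Field K] {m n : ℕ}

/-- Chain rule for `f = g(Ax + b)` (`MS2021.affSubst`):
`∂f/∂x_j = Σ_w (∂g/∂y_w)(Ax + b) · A_{w j}`. [cite: MediniShpilka2021, Def 3.6 (chain rule display; arXiv p0017.txt:L49-L51)] -/
theorem pderiv_affSubst (h : m ≤ n) (A : Matrix (Fin n) (Fin n) K) (b : Fin n → K)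
    (g : MvPolynomial (Fin m) K) (j : Fin n) :
    pderiv j (affSubst h A b g) =
      ∑ w : Fin m, affSubst h A b (pderiv w g) * C (A (Fin.castLE h w) j) := by
  classical
  unfold affSubst
  rw [_root_.Literature.Algebra.Polynomial.JacobianCriterion.pderiv_aeval]
  refine Finset.sum_congr rfl fun w _ => ?_
  congr 1
  simp only [map_add, map_sum, pderiv_C_mul, pderiv_C, add_zero, pderiv_X, Pi.single_apply,
    mul_ite, mul_one, mul_zero, Finset.sum_ite_eq', Finset.mem_univ, if_true]

/-- **Lemma 3.8** (derivative along a dual vector). For `f(x) = g(ℓ_1(x) + b_1, …, ℓ_m(x) + b_m)`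
with the `ℓ_w` = the first `m` rows of `A ∈ GL_n(K)`, and the dual vector `v_i :=` column
`castLE i` of `A⁻¹` (so `ℓ_w(v_i) = δ_{w i}`, Def 3.7): "`∂f/∂v_i (x) = (∂g/∂y_i)(ℓ_1(x), …, ℓ_m(x))`",
the directional derivative being `Σ_j v_{i,j} ∂f/∂x_j` (Def 3.6).
[cite: MediniShpilka2021, Lemma 3.8 and Defs 3.6–3.7 (arXiv p0017.txt:L44-L68; CCC §3)] -/
theorem sum_C_mul_pderiv_affSubst (h : m ≤ n) {A : Matrix (Fin n) (Fin n) K} (hA : IsUnit A.det)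
    (b : Fin n → K) (g : MvPolynomial (Fin m) K) (i : Fin m) :
    (∑ j, C (A⁻¹ j (Fin.castLE h i)) * pderiv j (affSubst h A b g)) =
      affSubst h A b (pderiv i g) := by
  classical
  simp_rw [pderiv_affSubst, Finset.mul_sum]
  rw [Finset.sum_comm]
  have hsum : ∀ w : Fin m,
      (∑ j, C (A⁻¹ j (Fin.castLE h i)) * (affSubst h A b (pderiv w g) * C (A (Fin.castLE h w) j))) =
        affSubst h A b (pderiv w g) * C ((A * A⁻¹) (Fin.castLE h w) (Fin.castLE h i)) := by
    intro w
    rw [Matrix.mul_apply, map_sum, Finset.mul_sum]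
    refine Finset.sum_congr rfl fun j _ => ?_
    rw [map_mul]
    ring
  simp_rw [hsum, Matrix.mul_nonsing_inv _ hA, Matrix.one_apply, (Fin.castLE_injective h).eq_iff]
  rw [Finset.sum_eq_single i (fun w _ hw => by rw [if_neg hw, map_zero, mul_zero])
    (fun hi => absurd (Finset.mem_univ i) hi), if_pos rfl, map_one, mul_one]

/-- **Thm 43, Case 1 step** (Lemma 3.8 packaged for orbits): for `f ∈ g^{GLaff_n(K)}` and every
coordinate `y_i` of `g` there is a direction `v ∈ K^n` with
`∂f/∂v = Σ_j v_j ∂f/∂x_j ∈ (∂g/∂y_i)^{GLaff_n(K)}` — indeed `∂f/∂v = (∂g/∂y_i)(Ax + b)` for the same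
`(A, b)` ("Choose `v` such that `ℓ_i(v) = 1`, and for all `j ≠ i`, `ℓ_j(v) = 0`. By (lem:dualder),
`∂f/∂v = (∂g/∂x_i)(Ax + b)`"). [cite: MediniShpilka2021, Lemma 3.8 (arXiv p0017.txt:L61-L68) and proof of Thm 43 Case 1 (p0034.txt:L50)] -/
theorem exists_dirDeriv_mem_affOrbit_pderiv {f : MvPolynomial (Fin n) K} {g : MvPolynomial (Fin m) K}
    (hf : f ∈ affOrbit n g) (i : Fin m) :
    ∃ v : Fin n → K, (∑ j, C (v j) * pderiv j f) ∈ affOrbit n (pderiv i g) := by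
  obtain ⟨h, A, b, hA, rfl⟩ := hf
  exact ⟨fun j => A⁻¹ j (Fin.castLE h i), h, A, b, hA, sum_C_mul_pderiv_affSubst h hA b g i⟩

end DualDerivative

/-! ### Lemma 3.10 (`k = 1`): the projection identity `f(x + L(x)·e_i) = g|_{y_r = 0}(Ãx + b̃)` -/

section Projection

variable {K : Type*} [Field K] {m n : ℕ}

/-- A row of an invertible matrix has a non-zero entry ("Let `x_i` be some variable with a non-zero
coefficient in `ℓ_1(x)`. Such a variable exists as the `ℓ_j`s are linearly independent").
[cite: MediniShpilka2021, proof of Lemma 3.10 (arXiv p0018.txt:L22)] -/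
theorem exists_apply_ne_zero_of_isUnit_det {A : Matrix (Fin n) (Fin n) K} (hA : IsUnit A.det)
    (s : Fin n) : ∃ i, A s i ≠ 0 := by
  by_contra hall
  push Not at hall
  have h0 : A.det = 0 := Matrix.det_eq_zero_of_row_eq_zero s hall
  exact not_isUnit_zero (h0 ▸ hA)

/-- Adding multiples of one row to the OTHER rows does not change the determinant: the matrix
`(A_{s j} + u_s A_{r j})` with `u_r = 0` is `(1 + u e_rᵀ) · A` and `det (1 + u e_rᵀ) = 1 + u_r = 1`
(matrix determinant lemma) — the step "as `ℓ_1, …, ℓ_m` are linearly independent, it follows that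
`ℓ̃_2, …, ℓ̃_m` are also linearly independent" of the proof of Lemma 3.10, for full invertible
matrices. [cite: MediniShpilka2021, proof of Lemma 3.10 (arXiv p0018.txt:L33-L35)] -/
theorem det_add_smul_row_eq (A : Matrix (Fin n) (Fin n) K) (r : Fin n) (u : Fin n → K)
    (hu : u r = 0) :
    (Matrix.of fun s j => A s j + u s * A r j).det = A.det := by
  classical
  have hE : (Matrix.of fun s j => A s j + u s * A r j) =
      (1 + replicateCol Unit u * replicateRow Unit (fun s' => if s' = r then (1 : K) else 0)) * A := by
    ext s j
    rw [Matrix.add_mul, Matrix.one_mul, Matrix.add_apply, Matrix.of_apply, Matrix.mul_apply]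
    congr 1
    simp only [Matrix.mul_apply, replicateCol_apply, replicateRow_apply, Finset.univ_unique,
      Finset.sum_singleton, mul_ite, mul_one, mul_zero, ite_mul, zero_mul, Finset.sum_ite_eq',
      Finset.mem_univ, if_true]
  rw [hE, det_mul, det_one_add_replicateCol_mul_replicateRow]
  have hdot : (fun s' => if s' = r then (1 : K) else 0) ⬝ᵥ u = 0 := by
    simp [dotProduct, hu]
  rw [hdot, add_zero, one_mul]

/-- **Lemma 3.10, `k = 1`, for the orbits `g(Ax + b)`** (the projection identity). Let
`f = g(Ax + b)` with `A ∈ GL_n(K)` (`ℓ_w + b_w` = row `w ≤ m` of `Ax + b`) and let `y_r` be a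
coordinate of `g`. Then for some variable `x_i` (one with `β_1 := A_{r i} ≠ 0`), the affine function
`L(x) := -(ℓ_r(x) + b_r)/β_1` and the invertible affine map `(Ã, b̃)` with rows
`ℓ̃_w + b̃_w = (ℓ_w + b_w) - (β_w/β_1)(ℓ_r + b_r)` (`w ≠ r`; row `r` unchanged):
"`f(x + G(α, L(x))) = f(x_1, …, x_i - ℓ_1(x)/β_1, …, x_n) = g(0, ℓ̃_2(x), …, ℓ̃_m(x)) = g̃(ℓ̃(x))`",
i.e. `f(x + L(x)·e_i) = g̃(Ãx + b̃)` with `g̃ := g|_{y_r = 0}` (kept `m`-variate).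
[cite: MediniShpilka2021, Lemma 3.10 (arXiv p0018.txt:L17-L40; CCC §3)] -/
theorem exists_shift_affSubst_eq (h : m ≤ n) {A : Matrix (Fin n) (Fin n) K} (hA : IsUnit A.det)
    (b : Fin n → K) (g : MvPolynomial (Fin m) K) (r : Fin m) :
    ∃ (i : Fin n) (L : MvPolynomial (Fin n) K) (A' : Matrix (Fin n) (Fin n) K) (b' : Fin n → K),
      A (Fin.castLE h r) i ≠ 0 ∧ IsUnit A'.det ∧
      bind₁ (fun j => X j + if j = i then L else 0) (affSubst h A b g) =
        affSubst h A' b' (aeval (fun w => if w = r then 0 else X w) g) := by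
  classical
  obtain ⟨i, hβ⟩ := exists_apply_ne_zero_of_isUnit_det hA (Fin.castLE h r)
  -- `u_s = -β_s/β_1` off the row `r`, `u_r = 0`
  obtain ⟨u, hudef⟩ : ∃ u : Fin n → K, u = fun s =>
      if s = Fin.castLE h r then 0 else -(A s i * (A (Fin.castLE h r) i)⁻¹) := ⟨_, rfl⟩
  have hur : u (Fin.castLE h r) = 0 := by rw [hudef]; exact if_pos rfl
  have hus : ∀ s, s ≠ Fin.castLE h r → u s = -(A s i * (A (Fin.castLE h r) i)⁻¹) := by
    intro s hs
    rw [hudef]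
    exact if_neg hs
  refine ⟨i, -(C (A (Fin.castLE h r) i)⁻¹ * ((∑ j, C (A (Fin.castLE h r) j) * X j) +
      C (b (Fin.castLE h r)))), Matrix.of fun s j => A s j + u s * A (Fin.castLE h r) j,
    fun s => b s + u s * b (Fin.castLE h r), hβ, ?_, ?_⟩
  · rw [det_add_smul_row_eq A _ u hur]
    exact hA
  · -- the identity, coordinate by coordinate of `g`
    unfold affSubst
    change aeval _ (aeval _ g) = aeval _ (aeval _ g)
    rw [← AlgHom.comp_apply, comp_aeval, ← AlgHom.comp_apply, comp_aeval]
    refine congrArg (fun F : Fin m → MvPolynomial (Fin n) K => aeval F g) (funext fun w => ?_)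
    dsimp only
    have hL : ∀ w' : Fin m, aeval (fun j : Fin n => X j + if j = i then
        -(C (A (Fin.castLE h r) i)⁻¹ * ((∑ j, C (A (Fin.castLE h r) j) * X j) +
          C (b (Fin.castLE h r)))) else 0)
        ((∑ j, C (A (Fin.castLE h w') j) * X j) + C (b (Fin.castLE h w'))) =
        (∑ j, C (A (Fin.castLE h w') j) * X j) + C (b (Fin.castLE h w')) -
          C (A (Fin.castLE h w') i) * C (A (Fin.castLE h r) i)⁻¹ *
            ((∑ j, C (A (Fin.castLE h r) j) * X j) + C (b (Fin.castLE h r))) := by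
      intro w'
      simp only [map_add, map_sum, map_mul, algHom_C, MvPolynomial.algebraMap_eq, aeval_X, mul_add,
        Finset.sum_add_distrib, mul_ite, mul_zero, Finset.sum_ite_eq', Finset.mem_univ, if_true]
      ring
    rw [hL]
    by_cases hw : w = r
    · subst hw
      rw [if_pos rfl, map_zero]
      have hββ : C (A (Fin.castLE h w) i) * C (A (Fin.castLE h w) i)⁻¹ =
          (1 : MvPolynomial (Fin n) K) := by
        rw [← map_mul, mul_inv_cancel₀ hβ, map_one]
      linear_combination (-((∑ j, C (A (Fin.castLE h w) j) * X j) + C (b (Fin.castLE h w)))) * hββ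
    · have hw' : Fin.castLE h w ≠ Fin.castLE h r := fun e => hw (Fin.castLE_injective h e)
      rw [if_neg hw, aeval_X]
      simp only [Matrix.of_apply, hus _ hw']
      have hfac : (∑ j, C (A (Fin.castLE h w) j + -(A (Fin.castLE h w) i * (A (Fin.castLE h r) i)⁻¹) *
          A (Fin.castLE h r) j) * (X j : MvPolynomial (Fin n) K)) =
          (∑ j, C (A (Fin.castLE h w) j) * X j) -
            C (A (Fin.castLE h w) i) * C (A (Fin.castLE h r) i)⁻¹ *
              ∑ j, C (A (Fin.castLE h r) j) * X j := by
        rw [Finset.mul_sum, ← Finset.sum_sub_distrib]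
        refine Finset.sum_congr rfl fun j _ => ?_
        simp only [map_add, map_mul, map_neg]
        ring
      rw [hfac, map_add, map_mul, map_neg, map_mul]
      ring

/-- **Thm 43, Case 2 step** (Lemma 3.10 packaged for orbits): for `f ∈ g^{GLaff_n(K)}` and a
coordinate `y_r` of `g`, some shift `f(x + L(x)·e_i)` (`L` affine) lies in the orbit of the
projection `g|_{y_r = 0}` — "there exist linearly independent linear functions `ℓ̃_2, …, ℓ̃_n`, an
assignment `α` and some linear function `L(x)` such that `f(x + G_1(α, L(x))) = g̃(ℓ̃_2(x), …)`".
Combine with `bind₁_sum_ne_zero_of_shift` / `bind₁_peel_ne_zero_of_shift`.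
[cite: MediniShpilka2021, Lemma 3.10 (arXiv p0018.txt:L17-L40) and proof of Thm 43 Case 2 (p0035.txt:L1)] -/
theorem exists_shift_mem_affOrbit {f : MvPolynomial (Fin n) K} {g : MvPolynomial (Fin m) K}
    (hf : f ∈ affOrbit n g) (r : Fin m) :
    ∃ (i : Fin n) (L : MvPolynomial (Fin n) K),
      bind₁ (fun j => X j + if j = i then L else 0) f ∈
        affOrbit n (aeval (fun w => if w = r then 0 else X w) g) := by
  obtain ⟨h, A, b, hA, rfl⟩ := hf
  obtain ⟨i, L, A', b', -, hA', hid⟩ := exists_shift_affSubst_eq h hA b g r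
  exact ⟨i, L, h, A', b', hA', hid⟩

end Projection

/-! ### Lemmas 3.9 and 3.10 for general `k`: "it is enough to prove the lemma for `k = 1` …
by iterative application of the result for `k = 1`" -/

section Iterate

universe u

variable {K : Type*} [CommSemiring K] {n t : ℕ}

/-- The variable map used to re-associate `(Fin k × V) ⊕ (V ⊕ τ) → (Fin (k+1) × V) ⊕ τ` after one
iteration step (block `0` := the peeled `1`-independent block). It is injective.
[cite: MediniShpilka2021, proof of Lemma 3.9, first paragraph (arXiv p0018.txt:L2-L3)] -/
theorem sumAssocPeel_injective {k : ℕ} {τ : Type u} :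
    Function.Injective (Sum.elim (fun p : Fin k × (Fin t ⊕ Unit) => Sum.inl (Prod.map Fin.succ id p))
      (Sum.elim (fun v : Fin t ⊕ Unit => Sum.inl ((0 : Fin (k + 1)), v)) Sum.inr) :
      (Fin k × (Fin t ⊕ Unit)) ⊕ ((Fin t ⊕ Unit) ⊕ τ) → (Fin (k + 1) × (Fin t ⊕ Unit)) ⊕ τ) := by
  rintro (⟨l, v⟩ | (v | w)) (⟨l', v'⟩ | (v' | w')) h <;>
    simp only [Sum.elim_inl, Sum.elim_inr, Prod.map, id_eq, Sum.inl.injEq, Sum.inr.injEq,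
      Prod.mk.injEq, Fin.succ_inj, reduceCtorEq] at h
  · rw [h.1, h.2]
  · exact absurd h.1 (Fin.succ_ne_zero l)
  · exact absurd h.1.symm (Fin.succ_ne_zero l')
  · rw [h.2]
  · rw [h]

/-- `k`-fold application written through `List.ofFn`: applying the operations `g (v l)` in turn is
folding `g` over the list of parameters. [folklore] -/
private theorem foldr_ofFn_apply {α β : Type*} {k : ℕ} (g : β → α → α) (v : Fin k → β) (a : α) :
    (List.ofFn fun l => g (v l)).foldr (fun op p => op p) a = (List.ofFn v).foldr g a := by
  induction k with
  | zero => simp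
  | succ k ih => simp only [List.ofFn_succ, List.foldr_cons, ih]

/-- **Iteration principle** behind the general-`k` Lemmas 3.9 / 3.10: if each of `k` operations
`op_l` on `K[x]` satisfies the `k = 1` statement "`op_l(p) ∘ H' ≠ 0 ⇒ p ∘ (G_1 + H') ≠ 0`" for EVERY
`1`-independent `G_1` and EVERY polynomial map `H'` in disjoint variables, then for a
`k`-independent `G = G_1 + ⋯ + G_k` and any `H`:
"`(op_1 ∘ ⋯ ∘ op_k)(f) ∘ H ≠ 0 ⇒ f ∘ (G + H) ≠ 0`" ("replace `f` with `∂^{k-1} f/∂v_2⋯∂v_k`, `H` with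
`H + G_2 + … + G_k` and `G` with `G_1`; by iterative application of the result for `k = 1`, we will
get the general result for an arbitrary `k`").
[cite: MediniShpilka2021, proof of Lemma 3.9, first paragraph, and proof of Lemma 3.10, first sentence (arXiv p0018.txt:L2-L3, L19-L20)] -/
theorem bind₁_sum_ne_zero_of_foldr (k : ℕ) :
    ∀ {τ : Type u} (ops : Fin k → MvPolynomial (Fin n) K → MvPolynomial (Fin n) K)
      (_ : ∀ (l : Fin k) (τ' : Type u) (G₁ : Fin n → MvPolynomial (Fin t ⊕ Unit) K),
        IsOneIndependent G₁ → ∀ (H' : Fin n → MvPolynomial τ' K) (p : MvPolynomial (Fin n) K),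
          bind₁ H' (ops l p) ≠ 0 →
            bind₁ (fun j => rename Sum.inl (G₁ j) + rename Sum.inr (H' j)) p ≠ 0)
      {G : Fin n → MvPolynomial (Fin k × (Fin t ⊕ Unit)) K} (_ : IsIndependent k G)
      (H : Fin n → MvPolynomial τ K) (f : MvPolynomial (Fin n) K),
      bind₁ H ((List.ofFn ops).foldr (fun op p => op p) f) ≠ 0 →
        bind₁ (fun j => rename Sum.inl (G j) + rename Sum.inr (H j)) f ≠ 0 := by
  induction k with
  | zero =>
    intro τ ops _ G hG H f h
    obtain ⟨Gs, -, hGeq⟩ := hG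
    have hG0 : ∀ j, G j = 0 := fun j => by rw [hGeq j]; exact Finset.sum_of_isEmpty _
    rw [List.ofFn_zero, List.foldr_nil] at h
    rw [show (fun j => rename Sum.inl (G j) + rename Sum.inr (H j)) =
      fun j => rename (Sum.inr : τ → (Fin 0 × (Fin t ⊕ Unit)) ⊕ τ) (H j) from
        funext fun j => by rw [hG0, map_zero, zero_add], ← rename_bind₁]
    exact ((rename_injective _ Sum.inr_injective).ne_iff' (map_zero _)).mpr h
  | succ k ih =>
    intro τ ops hops G hG H f h
    obtain ⟨G₁, G', hG₁, hG', hGeq⟩ := isIndependent_succ_iff.mp hG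
    rw [List.ofFn_succ, List.foldr_cons] at h
    -- the `k = 1` step for block `0`, with `H` …
    have step1 := hops 0 τ G₁ hG₁ H _ h
    -- … then the remaining `k` blocks, with `H ← G_1 + H`
    have step2 := ih (ops := fun l => ops l.succ) (fun l => hops l.succ) hG'
      (fun j => rename Sum.inl (G₁ j) + rename Sum.inr (H j)) f step1
    -- re-associate the variables
    set e : (Fin k × (Fin t ⊕ Unit)) ⊕ ((Fin t ⊕ Unit) ⊕ τ) → (Fin (k + 1) × (Fin t ⊕ Unit)) ⊕ τ :=
      Sum.elim (fun p : Fin k × (Fin t ⊕ Unit) => Sum.inl (Prod.map Fin.succ id p))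
        (Sum.elim (fun v : Fin t ⊕ Unit => Sum.inl ((0 : Fin (k + 1)), v)) Sum.inr) with he
    have e1 : e ∘ Sum.inl = Sum.inl ∘ Prod.map Fin.succ id := by rw [he]; rfl
    have e2 : e ∘ Sum.inr ∘ Sum.inl = Sum.inl ∘ Prod.mk (0 : Fin (k + 1)) := by rw [he]; rfl
    have e3 : e ∘ Sum.inr ∘ Sum.inr = Sum.inr := by rw [he]; rfl
    have key : rename e (bind₁ (fun j => rename Sum.inl (G' j) +
          rename Sum.inr (rename Sum.inl (G₁ j) + rename Sum.inr (H j))) f) =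
        bind₁ (fun j => rename Sum.inl (G j) + rename Sum.inr (H j)) f := by
      rw [rename_bind₁]
      refine congrArg (fun F : Fin n → MvPolynomial ((Fin (k + 1) × (Fin t ⊕ Unit)) ⊕ τ) K =>
        bind₁ F f) (funext fun j => ?_)
      rw [hGeq j]
      simp only [map_add, rename_rename]
      rw [e1, e2, e3]
      abel
    rw [← key]
    exact ((rename_injective _ sumAssocPeel_injective).ne_iff' (map_zero _)).mpr step2

/-- **Lemma 3.9 (general `k`, as printed).** `G(y, z)` a `k`-independent map, `H(w)` any polynomial
map in disjoint variables, `v_1, …, v_k ∈ K^n`: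
"`∂^k f/∂v_1∂v_2⋯∂v_k ∘ H ≠ 0 ⇒ f ∘ (G + H) ≠ 0`", the iterated directional derivative being
`D_{v_1}(D_{v_2}(⋯ D_{v_k} f))` with `D_v p = Σ_i v_i ∂p/∂x_i` (Def 3.6).
[cite: MediniShpilka2021, Lemma 3.9 (arXiv p0017.txt:L70-L73, proof p0018.txt:L1-L13; CCC §3)] -/
theorem IsIndependent.bind₁_sum_ne_zero_of_iterate_dirDeriv {K : Type*} [CommRing K] {n t k : ℕ}
    {τ : Type u} {G : Fin n → MvPolynomial (Fin k × (Fin t ⊕ Unit)) K} (hG : IsIndependent k G)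
    (H : Fin n → MvPolynomial τ K) (f : MvPolynomial (Fin n) K) (v : Fin k → Fin n → K)
    (h : bind₁ H ((List.ofFn v).foldr (fun w p => ∑ i, C (w i) * pderiv i p) f) ≠ 0) :
    bind₁ (fun j => rename Sum.inl (G j) + rename Sum.inr (H j)) f ≠ 0 := by
  refine bind₁_sum_ne_zero_of_foldr k (fun l p => ∑ i, C (v l i) * pderiv i p)
    (fun l τ' G₁ hG₁ H' p hp => bind₁_sum_ne_zero_of_dirDeriv hG₁ H' p (v l) hp) hG H f ?_
  have e := foldr_ofFn_apply (fun (w : Fin n → K) (p : MvPolynomial (Fin n) K) =>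
    ∑ i, C (w i) * pderiv i p) v f
  rw [← e] at h
  exact h

/-- **Lemma 3.10 (general `k`, iterated form).** `G(y, z)` a `k`-independent map, `H(w)` any
polynomial map in disjoint variables, indices `i_1, …, i_k` and polynomials `L_1(x), …, L_k(x)`:
if the `k`-fold shifted polynomial `f(x + L_1 e_{i_1})(x + L_2 e_{i_2})⋯` (sequential
substitutions `x ↦ x + L_l(x)·e_{i_l}`, innermost `l = k`) composed with `H` is non-zero, then
`f ∘ (G + H) ≠ 0` — the paper's "apply the result iteratively" for `f(x + G(α, L⃗(x)))`; combine with
`exists_shift_affSubst_eq` once per killed coordinate to reach `g̃ = g|_{S = 0}`.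
[cite: MediniShpilka2021, Lemma 3.10 (arXiv p0018.txt:L15-L40; CCC §3)] -/
theorem IsIndependent.bind₁_sum_ne_zero_of_iterate_shift {k : ℕ} {τ : Type u}
    {G : Fin n → MvPolynomial (Fin k × (Fin t ⊕ Unit)) K} (hG : IsIndependent k G)
    (H : Fin n → MvPolynomial τ K) (f : MvPolynomial (Fin n) K) (i : Fin k → Fin n)
    (L : Fin k → MvPolynomial (Fin n) K)
    (h : bind₁ H ((List.ofFn fun l => (i l, L l)).foldr
      (fun q p => bind₁ (fun j => X j + if j = q.1 then q.2 else 0) p) f) ≠ 0) :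
    bind₁ (fun j => rename Sum.inl (G j) + rename Sum.inr (H j)) f ≠ 0 := by
  refine bind₁_sum_ne_zero_of_foldr k
    (fun l p => bind₁ (fun j => X j + if j = i l then L l else 0) p)
    (fun l τ' G₁ hG₁ H' p hp => bind₁_sum_ne_zero_of_shift hG₁ H' p (i l) (L l) hp) hG H f ?_
  have e := foldr_ofFn_apply (fun (q : Fin n × MvPolynomial (Fin n) K) (p : MvPolynomial (Fin n) K) =>
    bind₁ (fun j => X j + if j = q.1 then q.2 else 0) p) (fun l => (i l, L l)) f
  rw [← e] at h
  exact h

end Iterate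




end MS2021

end Literature.Computability.AlgebraicComplexity

end
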